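import Mathlib

/-!
# Parabola lifts and tangency sets — wall-breaker axis `parabola lifts over finite fields`
for the packing stub `stub_tangencySets` of the crux `LevelOneGL2Designs`
(stmt-MatrixMultiplication-14080, route `LevelGradedCohnUmans`)

The stub asks for strong representative systems (SRS) of `AG(2,p)` of size `c · p^{3/2}` for
unboundedly many primes `p`: finite sets `S` of flags `f = (x, y)`, `x, y : Fin 2 → ZMod p`, the
line of `y` being `{v : v ⬝ᵥ y = 1}`, with `f.1 ⬝ᵥ f'.2 = 1 ↔ f = f'`.

**The parabola lift.**  Lift `t : ZMod p` to the point `(t, t² + s)` of the parabola `Π_s : y = x² + s`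
and attach to it the tangent line of `Π_s` there, `2t·x − y = t² − s`.  The one-parameter group
`(x, y) ↦ (x + c, y + 2cx + c²)` acts regularly on every `Π_s` and permutes the lines, so incidence
between the lifted flags depends only on the parameters:

  `(t, t² + s)` lies on the tangent of `Π_{s'}` at `t'`  `⟺  (t − t')² = s − s'`.

Hence (Theorem `srs_of_coclique`) a set `S ⊆ ZMod p` all of whose non-zero differences are
NON-SQUARES (a coclique of the Paley graph) lifts to an SRS of size `≥ (p − 2)·|S|` in the stub's
format, and (Theorem `tangencySets_of_large_cocliques`) cocliques of size `c·√p` along an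
unbounded set of primes would give the stub verbatim.  Conversely (Theorem `hasTangent_iff`) a point
of the lifted set `X_S = ⋃_{s ∈ S} Π_s` has a tangent line of ANY kind iff `S = {s}` or `s − s'` is a
non-square for every other `s' ∈ S`; so `X_S` is a tangency set iff `|S| ≤ 1` or `S` is a Paley
coclique (`parabolaPencil_isTangencySet_iff`): the axis reduces the stub EXACTLY to large Paley
cocliques.  Finally (Theorems `card_clique_mul_card_coclique_le`, `card_coclique_sq_le`) a clique and a
coclique of the Paley graph have `|C|·|I| ≤ p`, whence `|I|² ≤ p`: the architecture can never exceed
`p^{3/2}` flags, and it reaches order `p^{3/2}` only if Paley cocliques of order `√p` exist for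
infinitely many primes — known for NO prime (record `Ω(log p · log log log p)`, Graham–Ringrose 1990),
and contradicting the standard expectation `ω(P_p) = p^{o(1)}`.  For `q` square the same lift with
`S = ν·𝔽_√q` is the Illés–Szőnyi–Wettl / Buekenhout–Metz parabola unital; for primes `q ≡ 1 (4)` it is
the `c·q·log q` construction of Szőnyi–Cossidente–Gács–Mengyán–Siciliano–Weiner (2005).

All statements are elementary and fully proved (no named facts); no new definitions.
-/

set_option linter.dupNamespace false

noncomputable section

open Finset Matrix

namespace Summit.MatrixMultiplication.MatrixMultiplication.Theorems.LevelOneGL2Designs.ParabolaLift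

variable {p : ℕ} [Fact p.Prime]

/-- Over `ZMod p` the equation `t² = s` has at most two solutions. [elementary] -/
theorem card_filter_sq_eq_le_two (s : ZMod p) :
    (univ.filter fun t : ZMod p => t ^ 2 = s).card ≤ 2 := by
  classical
  by_cases h : ∃ r : ZMod p, r ^ 2 = s
  · obtain ⟨r, rfl⟩ := h
    calc (univ.filter fun t : ZMod p => t ^ 2 = r ^ 2).card
        ≤ ({r, -r} : Finset (ZMod p)).card := by
          apply card_le_card
          intro t ht
          simp only [mem_filter, mem_univ, true_and] at ht
          rcases sq_eq_sq_iff_eq_or_eq_neg.mp ht with h1 | h1 <;> simp [h1]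
      _ ≤ 2 := card_le_two
  · have : (univ.filter fun t : ZMod p => t ^ 2 = s) = ∅ := by
      apply filter_eq_empty_iff.mpr
      intro t _ ht
      exact h ⟨t, ht⟩
    simp [this]

/-- **The parabola lift (construction).**  If `S ⊆ ZMod p` has no two distinct elements differing
by a square (a coclique of the Paley graph), then the flags
`(t, s) ↦ ( (t, t² + s) , tangent line 2t·x − y = t² − s of the parabola y = x² + s )`,
over all `t : ZMod p`, `s ∈ S` with `t² ≠ s` (so that the tangent misses the origin and can be written
`{v : v ⬝ᵥ y = 1}`), form a strong representative system of `AG(2,p)` of size `≥ p·|S| − 2·|S|`: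
the point of `(t, s)` lies on the line of `(t', s')` iff `(t − t')² = s − s'`. [elementary;
the parabola step of Illés–Szőnyi–Wettl 1991 and Szőnyi et al. 2005, over a prime field] -/
theorem srs_of_coclique (S : Finset (ZMod p))
    (hS : ∀ s ∈ S, ∀ s' ∈ S, s ≠ s' → ¬ IsSquare (s - s')) :
    ∃ F : Finset ((Fin 2 → ZMod p) × (Fin 2 → ZMod p)),
      p * S.card ≤ F.card + 2 * S.card ∧
      ∀ f ∈ F, ∀ f' ∈ F, (dotProduct f.1 f'.2 = 1 ↔ f = f') := by
  classical
  -- the lift of the parameter pair `(t, s)`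
  let flag : ZMod p × ZMod p → (Fin 2 → ZMod p) × (Fin 2 → ZMod p) :=
    fun ts => (![ts.1, ts.1 ^ 2 + ts.2], (ts.1 ^ 2 - ts.2)⁻¹ • ![2 * ts.1, -1])
  have hinj : Function.Injective flag := by
    rintro ⟨t, s⟩ ⟨t', s'⟩ h
    simp only [flag, Prod.mk.injEq] at h
    obtain ⟨h1, -⟩ := h
    have ht : t = t' := by simpa using congr_fun h1 0
    have hs : t ^ 2 + s = t' ^ 2 + s' := by simpa using congr_fun h1 1
    subst ht
    exact Prod.ext rfl (add_left_cancel hs)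
  -- admissible parameters: `t² ≠ s`
  let P : Finset (ZMod p × ZMod p) := (univ ×ˢ S).filter fun ts => ts.1 ^ 2 ≠ ts.2
  refine ⟨P.image flag, ?_, ?_⟩
  · rw [card_image_of_injective _ hinj]
    have hsplit := card_filter_add_card_filter_not (s := univ ×ˢ S)
      (fun ts : ZMod p × ZMod p => ts.1 ^ 2 ≠ ts.2)
    have hbad : ((univ ×ˢ S).filter fun ts : ZMod p × ZMod p => ¬ ts.1 ^ 2 ≠ ts.2).card
        ≤ 2 * S.card := by
      calc ((univ ×ˢ S).filter fun ts : ZMod p × ZMod p => ¬ ts.1 ^ 2 ≠ ts.2).card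
          ≤ (S.biUnion fun s => (univ.filter fun t : ZMod p => t ^ 2 = s) ×ˢ {s}).card := by
            apply card_le_card
            intro ts hts
            simp only [mem_filter, mem_product, mem_univ, true_and, not_not] at hts
            simp only [mem_biUnion, mem_product, mem_filter, mem_univ, true_and, mem_singleton]
            exact ⟨ts.2, hts.1, hts.2, rfl⟩
        _ ≤ ∑ s ∈ S, ((univ.filter fun t : ZMod p => t ^ 2 = s) ×ˢ ({s} : Finset (ZMod p))).card :=
            card_biUnion_le
        _ ≤ ∑ s ∈ S, 2 := by
            apply sum_le_sum
            intro s _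
            rw [card_product, card_singleton, mul_one]
            exact card_filter_sq_eq_le_two s
        _ = 2 * S.card := by rw [sum_const, smul_eq_mul, mul_comm]
    have hcard : ((univ : Finset (ZMod p)) ×ˢ S).card = p * S.card := by
      rw [card_product, card_univ, ZMod.card]
    calc p * S.card = P.card + ((univ ×ˢ S).filter
          fun ts : ZMod p × ZMod p => ¬ ts.1 ^ 2 ≠ ts.2).card := by rw [← hcard, ← hsplit]
      _ ≤ P.card + 2 * S.card := by gcongr
  · intro f hf f' hf'
    simp only [mem_image] at hf hf'
    obtain ⟨⟨t, s⟩, hts, rfl⟩ := hf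
    obtain ⟨⟨t', s'⟩, hts', rfl⟩ := hf'
    simp only [P, mem_filter, mem_product, mem_univ, true_and] at hts hts'
    have key : (flag (t, s)).1 ⬝ᵥ (flag (t', s')).2
        = (t' ^ 2 - s')⁻¹ * (2 * t * t' - t ^ 2 - s) := by
      simp only [flag, dotProduct_smul, vec2_dotProduct', smul_eq_mul]
      ring
    rw [key, inv_mul_eq_one₀ (sub_ne_zero.mpr hts'.2)]
    constructor
    · intro h
      have hsq : IsSquare (s' - s) := ⟨t' - t, by linear_combination -h⟩
      have hss : s' = s := by
        by_contra hne
        exact hS s' hts'.1 s hts.1 hne hsq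
      subst hss
      have htt : (t' - t) ^ 2 = 0 := by linear_combination h
      have htt' : t' = t := sub_eq_zero.mp ((pow_eq_zero_iff two_ne_zero).mp htt)
      subst htt'
      rfl
    · intro h
      obtain ⟨rfl, rfl⟩ := Prod.mk.injEq _ _ _ _ ▸ hinj h
      ring

/-- **Conditional form of the stub along this axis.**  If Paley cocliques of size `c·√p` exist in
`ZMod p` for unboundedly many primes `p`, then `stub_tangencySets` holds verbatim (with constant
`c/3`): the parabola lift of such a coclique has `≥ (p−2)·c·√p ≥ (c/3)·p^{3/2}` flags.  The
hypothesis is the exact residual of the axis (see `parabolaPencil_isTangencySet_iff`); it is open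
for every prime and contradicts the expected `p^{o(1)}` clique number of Paley graphs. [elementary] -/
theorem tangencySets_of_large_cocliques
    (H : ∃ c : ℝ, 0 < c ∧ ∀ p₀ : ℕ, ∃ (p : ℕ) (_ : Fact p.Prime), p₀ ≤ p ∧
      ∃ S : Finset (ZMod p), c * (p : ℝ) ^ (1 / 2 : ℝ) ≤ S.card ∧
        ∀ s ∈ S, ∀ s' ∈ S, s ≠ s' → ¬ IsSquare (s - s')) :
    ∃ c : ℝ, 0 < c ∧ ∀ p₀ : ℕ, ∃ (p : ℕ) (_ : Fact p.Prime), p₀ ≤ p ∧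
      ∃ S : Finset ((Fin 2 → ZMod p) × (Fin 2 → ZMod p)),
        c * (p : ℝ) ^ (3 / 2 : ℝ) ≤ S.card ∧
        ∀ f ∈ S, ∀ f' ∈ S, (dotProduct f.1 f'.2 = 1 ↔ f = f') := by
  obtain ⟨c, hc, hH⟩ := H
  refine ⟨c / 3, by positivity, fun p₀ => ?_⟩
  obtain ⟨p, hp, hp₀, S, hS, hco⟩ := hH (max p₀ 3)
  obtain ⟨F, hF, hsrs⟩ := srs_of_coclique S hco
  refine ⟨p, hp, le_of_max_le_left hp₀, F, ?_, hsrs⟩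
  have h3 : (3 : ℝ) ≤ p := by exact_mod_cast le_of_max_le_right hp₀
  have hp0 : (0 : ℝ) < p := by linarith
  have hF' : (p : ℝ) * S.card ≤ F.card + 2 * S.card := by exact_mod_cast hF
  have hrpow : (p : ℝ) ^ (3 / 2 : ℝ) = p * (p : ℝ) ^ (1 / 2 : ℝ) := by
    rw [show (3 / 2 : ℝ) = 1 + 1 / 2 by norm_num, Real.rpow_add hp0, Real.rpow_one]
  rw [hrpow, show c / 3 * (p * (p : ℝ) ^ (1 / 2 : ℝ)) = p / 3 * (c * (p : ℝ) ^ (1 / 2 : ℝ)) by ring]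
  have hS0 : (0 : ℝ) ≤ S.card := by positivity
  calc (p : ℝ) / 3 * (c * (p : ℝ) ^ (1 / 2 : ℝ)) ≤ p / 3 * S.card := by gcongr
    _ ≤ (p - 2) * S.card := by nlinarith
    _ ≤ F.card := by linarith

/-- **Exactness of the reduction (one point).**  For the lifted set `X_S = {(t, t² + s) : t ∈ ZMod p,
s ∈ S}` and a point `(t₀, t₀² + s₀)` of it, the following are equivalent:
(i) some affine line through the point (normal vector `a ≠ 0`, ANY line: through the origin or not,
vertical or not) meets `X_S` in that point only;
(ii) `S = {s₀}`, or `s₀ − s` is a non-square for every other `s ∈ S`.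
Proof: a vertical line contains the whole fibre `{(t₀, t₀² + s) : s ∈ S}`; a non-vertical line
through the point meets the parabola `y = x² + s₀` again unless it is its tangent, and the tangent at
`t₀` contains `(t₀ + r, (t₀ + r)² + s)` iff `r² = s₀ − s`. [elementary] -/
theorem hasTangent_iff (S : Finset (ZMod p)) {s₀ : ZMod p} (hs₀ : s₀ ∈ S) (t₀ : ZMod p) :
    (∃ a : Fin 2 → ZMod p, a ≠ 0 ∧ ∀ t : ZMod p, ∀ s ∈ S,
        a ⬝ᵥ ![t, t ^ 2 + s] = a ⬝ᵥ ![t₀, t₀ ^ 2 + s₀] → t = t₀ ∧ s = s₀) ↔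
    (S = {s₀} ∨ ∀ s ∈ S, s ≠ s₀ → ¬ IsSquare (s₀ - s)) := by
  constructor
  · rintro ⟨a, ha, h⟩
    by_cases h1 : a 1 = 0
    · -- vertical line: it contains the whole fibre over `t₀`
      left
      refine eq_singleton_iff_unique_mem.mpr ⟨hs₀, fun s hs => (h t₀ s hs ?_).2⟩
      simp only [vec2_dotProduct, cons_val_zero, cons_val_one, h1, zero_mul, add_zero]
    · -- non-vertical line: it must be the tangent, and the tangent sees square differences
      right
      have hslope : a 0 = -2 * t₀ * a 1 := by
        have key := (h (-t₀ - a 0 / a 1) s₀ hs₀ ?_).1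
        · field_simp at key
          linear_combination -key
        · simp only [vec2_dotProduct, cons_val_zero, cons_val_one]
          field_simp
          ring
      intro s hs hne hsq
      obtain ⟨r, hr⟩ := hsq
      have key := (h (t₀ + r) s hs ?_).2
      · exact hne key
      · simp only [vec2_dotProduct, cons_val_zero, cons_val_one, hslope]
        linear_combination (-(a 1)) * hr
  · rintro (hS | hco)
    · refine ⟨![1, 0], ?_, ?_⟩
      · intro h
        simpa using congr_fun h 0
      · intro t s hs heq
        subst hS
        refine ⟨?_, mem_singleton.mp hs⟩
        simpa [vec2_dotProduct] using heq
    · refine ⟨![2 * t₀, -1], ?_, ?_⟩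
      · intro h
        simpa using congr_fun h 1
      · intro t s hs heq
        simp only [vec2_dotProduct, cons_val_zero, cons_val_one] at heq
        have hsq : IsSquare (s₀ - s) := ⟨t - t₀, by linear_combination heq⟩
        have hss : s = s₀ := by
          by_contra hne
          exact hco s hs hne hsq
        subst hss
        have htt : (t - t₀) ^ 2 = 0 := by linear_combination -heq
        exact ⟨sub_eq_zero.mp ((pow_eq_zero_iff two_ne_zero).mp htt), rfl⟩

/-- **Exactness of the reduction (whole set).**  Every point of the lifted set
`X_S = ⋃_{s ∈ S} {y = x² + s}` has a tangent line (a line meeting `X_S` only there) iff `|S| ≤ 1` or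
`S` is a coclique of the Paley graph (no two distinct elements differ by a square).  So unions of
translated parabolas give tangency sets / strong representative systems of `AG(2,p)` of size
`p·|S|` EXACTLY when `S` is a Paley coclique: the parabola-lift axis reduces `stub_tangencySets`
exactly to Paley cocliques of size `≥ c·√p`. [elementary] -/
theorem parabolaPencil_isTangencySet_iff (S : Finset (ZMod p)) :
    (∀ s₀ ∈ S, ∀ t₀ : ZMod p, ∃ a : Fin 2 → ZMod p, a ≠ 0 ∧ ∀ t : ZMod p, ∀ s ∈ S,
        a ⬝ᵥ ![t, t ^ 2 + s] = a ⬝ᵥ ![t₀, t₀ ^ 2 + s₀] → t = t₀ ∧ s = s₀) ↔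
    (S.card ≤ 1 ∨ ∀ s ∈ S, ∀ s' ∈ S, s ≠ s' → ¬ IsSquare (s - s')) := by
  constructor
  · intro h
    by_cases hc : S.card ≤ 1
    · exact Or.inl hc
    · right
      intro s hs s' hs' hne
      rcases (hasTangent_iff S hs 0).mp (h s hs 0) with h1 | h2
      · exact absurd (by rw [h1, card_singleton]) hc
      · exact h2 s' hs' (Ne.symm hne)
  · rintro h s₀ hs₀ t₀
    apply (hasTangent_iff S hs₀ t₀).mpr
    rcases h with h1 | h2
    · exact Or.inl (eq_singleton_iff_unique_mem.mpr
        ⟨hs₀, fun x hx => card_le_one.mp h1 x hx s₀ hs₀⟩)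
    · exact Or.inr fun s hs hne => h2 s₀ hs₀ s hs (Ne.symm hne)

/-- **Clique–coclique bound.**  In `ZMod p`, if all non-zero differences inside `C` are squares and
all non-zero differences inside `I` are non-squares, then `|C|·|I| ≤ p`: the map `(c, i) ↦ i − c` is
injective on `C × I` (two pairs with the same difference would give `i − i' = c − c'`, a square and a
non-square at once). [elementary; the clique–coclique bound for Cayley graphs] -/
theorem card_clique_mul_card_coclique_le (C I : Finset (ZMod p))
    (hC : ∀ x ∈ C, ∀ y ∈ C, x ≠ y → IsSquare (x - y))
    (hI : ∀ x ∈ I, ∀ y ∈ I, x ≠ y → ¬ IsSquare (x - y)) :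
    C.card * I.card ≤ p := by
  classical
  have hinj : Set.InjOn (fun ci : ZMod p × ZMod p => ci.2 - ci.1) ↑(C ×ˢ I) := by
    rintro ⟨c, i⟩ hci ⟨c', i'⟩ hci' h
    simp only [coe_product, Set.mem_prod, mem_coe] at hci hci'
    change i - c = i' - c' at h
    by_cases hii : i = i'
    · subst hii
      have hcc : c = c' := by linear_combination -h
      subst hcc
      rfl
    · exfalso
      have hcc : c ≠ c' := fun hcc => hii (by subst hcc; linear_combination h)
      have h1 : IsSquare (c - c') := hC c hci.1 c' hci'.1 hcc
      have h2 : ¬ IsSquare (i - i') := hI i hci.2 i' hci'.2 hii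
      exact h2 (by rwa [show i - i' = c - c' by linear_combination h])
  calc C.card * I.card = (C ×ˢ I).card := (card_product _ _).symm
    _ ≤ (univ : Finset (ZMod p)).card :=
        card_le_card_of_injOn _ (fun _ _ => mem_coe.mpr (mem_univ _)) hinj
    _ = p := by rw [card_univ, ZMod.card]

/-- **Paley cocliques have at most `√p` elements.**  If no two distinct elements of `I ⊆ ZMod p`
differ by a square then `|I|² ≤ p` (multiply `I` by a non-square to get a clique of the same size and
apply `card_clique_mul_card_coclique_le`).  Consequently the parabola-lift architecture produces at
most `p·√p` flags, and produces order `p^{3/2}` only from cocliques of order `√p`. [elementary] -/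
theorem card_coclique_sq_le (I : Finset (ZMod p))
    (hI : ∀ x ∈ I, ∀ y ∈ I, x ≠ y → ¬ IsSquare (x - y)) : I.card * I.card ≤ p := by
  classical
  by_cases h2 : ringChar (ZMod p) = 2
  · have hI1 : I.card ≤ 1 := by
      rw [card_le_one]
      intro x hx y hy
      by_contra hxy
      exact hI x hx y hy hxy (FiniteField.isSquare_of_char_two h2 (x - y))
    nlinarith [(Fact.out : p.Prime).two_le]
  · obtain ⟨ν, hν⟩ := FiniteField.exists_nonsquare h2
    have hν0 : ν ≠ 0 := fun h => hν (h ▸ IsSquare.zero)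
    have hC : ∀ x ∈ I.image (ν * ·), ∀ y ∈ I.image (ν * ·), x ≠ y → IsSquare (x - y) := by
      simp only [mem_image]
      rintro _ ⟨x, hx, rfl⟩ _ ⟨y, hy, rfl⟩ hne
      have hxy : x ≠ y := fun h => hne (by rw [h])
      have hχν : quadraticChar (ZMod p) ν = -1 := quadraticChar_neg_one_iff_not_isSquare.mpr hν
      have hχd : quadraticChar (ZMod p) (x - y) = -1 :=
        quadraticChar_neg_one_iff_not_isSquare.mpr (hI x hx y hy hxy)
      have hprod : quadraticChar (ZMod p) (ν * (x - y)) = 1 := by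
        rw [map_mul, hχν, hχd]; norm_num
      rw [← mul_sub]
      exact (quadraticChar_one_iff_isSquare (mul_ne_zero hν0 (sub_ne_zero.mpr hxy))).mp hprod
    calc I.card * I.card = (I.image (ν * ·)).card * I.card := by
          rw [card_image_of_injective _ (mul_right_injective₀ hν0)]
      _ ≤ p := card_clique_mul_card_coclique_le _ I hC hI

/-- **The master lemma of the axis (thinned pencils).**  For parameter sets `T, S ⊆ ZMod p` lift `(t, s)` to the
point `(t, t² + s)` with the tangent of `y = x² + s` there.  The lifted flags (those with `t² ≠ s`, at least
`|T|·|S| − 2|S|` of them) form a strong representative system as soon as the only solution of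
`(t − t')² = s − s'` with `t, t' ∈ T`, `s, s' ∈ S` is the trivial one — the incidence identity (★) of the parabola
lift.  `srs_of_coclique` is the case `T = univ` (then (★) says: `S` is a Paley coclique), and the integer lift of the
companion file `…TangencyIntegerLift` is the case `T = [0, L)`, `S ⊆ [0, N)` cast from `ℕ` with `L² + N ≤ p`
(then (★) says: `S` has no perfect-square differences). [elementary] -/
theorem srs_of_sqDiff_disjoint (T S : Finset (ZMod p))
    (h : ∀ t ∈ T, ∀ s ∈ S, ∀ t' ∈ T, ∀ s' ∈ S, (t - t') ^ 2 = s - s' → t = t' ∧ s = s') :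
    ∃ F : Finset ((Fin 2 → ZMod p) × (Fin 2 → ZMod p)),
      T.card * S.card ≤ F.card + 2 * S.card ∧
      ∀ f ∈ F, ∀ f' ∈ F, (dotProduct f.1 f'.2 = 1 ↔ f = f') := by
  classical
  let flag : ZMod p × ZMod p → (Fin 2 → ZMod p) × (Fin 2 → ZMod p) :=
    fun ts => (![ts.1, ts.1 ^ 2 + ts.2], (ts.1 ^ 2 - ts.2)⁻¹ • ![2 * ts.1, -1])
  have hinj : Function.Injective flag := by
    rintro ⟨t, s⟩ ⟨t', s'⟩ h
    simp only [flag, Prod.mk.injEq] at h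
    obtain ⟨h1, -⟩ := h
    have ht : t = t' := by simpa using congr_fun h1 0
    have hs : t ^ 2 + s = t' ^ 2 + s' := by simpa using congr_fun h1 1
    subst ht
    exact Prod.ext rfl (add_left_cancel hs)
  let P : Finset (ZMod p × ZMod p) := (T ×ˢ S).filter fun ts => ts.1 ^ 2 ≠ ts.2
  refine ⟨P.image flag, ?_, ?_⟩
  · rw [card_image_of_injective _ hinj]
    have hsplit := card_filter_add_card_filter_not (s := T ×ˢ S)
      (fun ts : ZMod p × ZMod p => ts.1 ^ 2 ≠ ts.2)
    have hbad : ((T ×ˢ S).filter fun ts : ZMod p × ZMod p => ¬ ts.1 ^ 2 ≠ ts.2).card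
        ≤ 2 * S.card := by
      calc ((T ×ˢ S).filter fun ts : ZMod p × ZMod p => ¬ ts.1 ^ 2 ≠ ts.2).card
          ≤ (S.biUnion fun s => (univ.filter fun t : ZMod p => t ^ 2 = s) ×ˢ {s}).card := by
            apply card_le_card
            intro ts hts
            simp only [mem_filter, mem_product, not_not] at hts
            simp only [mem_biUnion, mem_product, mem_filter, mem_univ, true_and, mem_singleton]
            exact ⟨ts.2, hts.1.2, hts.2, rfl⟩
        _ ≤ ∑ s ∈ S, ((univ.filter fun t : ZMod p => t ^ 2 = s) ×ˢ ({s} : Finset (ZMod p))).card :=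
            card_biUnion_le
        _ ≤ ∑ s ∈ S, 2 := by
            apply sum_le_sum
            intro s _
            rw [card_product, card_singleton, mul_one]
            exact card_filter_sq_eq_le_two s
        _ = 2 * S.card := by rw [sum_const, smul_eq_mul, mul_comm]
    have hcard : (T ×ˢ S).card = T.card * S.card := card_product _ _
    calc T.card * S.card = P.card + ((T ×ˢ S).filter
          fun ts : ZMod p × ZMod p => ¬ ts.1 ^ 2 ≠ ts.2).card := by rw [← hcard, ← hsplit]
      _ ≤ P.card + 2 * S.card := by gcongr
  · intro f hf f' hf'
    simp only [mem_image] at hf hf'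
    obtain ⟨⟨t, s⟩, hts, rfl⟩ := hf
    obtain ⟨⟨t', s'⟩, hts', rfl⟩ := hf'
    simp only [P, mem_filter, mem_product] at hts hts'
    have key : (flag (t, s)).1 ⬝ᵥ (flag (t', s')).2
        = (t' ^ 2 - s')⁻¹ * (2 * t * t' - t ^ 2 - s) := by
      simp only [flag, dotProduct_smul, vec2_dotProduct', smul_eq_mul]
      ring
    rw [key, inv_mul_eq_one₀ (sub_ne_zero.mpr hts'.2)]
    constructor
    · intro hh
      have hsq : (t' - t) ^ 2 = s' - s := by linear_combination hh
      obtain ⟨rfl, rfl⟩ := h t' hts'.1.1 s' hts'.1.2 t hts.1.1 s hts.1.2 hsq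
      rfl
    · intro hh
      obtain ⟨rfl, rfl⟩ := Prod.mk.injEq _ _ _ _ ▸ hinj hh
      ring

end Summit.MatrixMultiplication.MatrixMultiplication.Theorems.LevelOneGL2Designs.ParabolaLift
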